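import Mathlib
import HarnessLib.Audit
import Summits.PneNP.PneNP.Theorems.PstarChordBridgeBundle

/-!
# Complete multipartite AND-patterns inside an expanding core are tiny (ROUND-24, memo §4 "bundles are expansion-dead"; R7 (i′))

FRONTIER range-avoidance ladder, rung F-N3, ROUND 24 (cell `pnp-ideate`, planner memo `r24/CORE-BOUND-NOTES.md` §4 (the `K_{2,2}` / `K_4` bundles:
"every variable used twice ⇒ a path with these monomials has no private AND slot ⇒ dead by expansion"), §5.1; restricted-model proof complexity —
nothing here bears on `P` versus `NP`).

`PstarChordBridgeBundle.bundle_adj` says that two chords forming an elliptic bundle have fundamental sets whose symmetric difference `S` has a COMPLETE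
MULTIPARTITE AND-graph: `c ~ d` in `S` iff `ω(v_c, v_d) = 1` for the labels `v_c = (ℓ₁(e_c), ℓ₂(e_c)) ∈ 𝔽₂²`.  This file does the accounting:

* `card_le_two_of_pattern` — **a family `S` of outputs of a pure `(r,3/2)`-expanding instance with simple overlaps, `#S ≤ r`, at most four XOR
  vertices of odd slot-degree, and a complete multipartite AND-graph (`AndAdj S c d ↔ ω(v c, v d) = 1` for some labelling `v`) has at most TWO
  outputs.**  Proof: if some variable lies in every AND pair (a star), the outputs are pairwise XOR-disjoint by simple overlaps, so all their XOR
  vertices are odd: `2·#S ≤ 4`; otherwise every AND variable of `S` lies in two outputs of `S` (a lone partner would force a star), so the boundary of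
  `S` consists of odd XOR vertices only: `3·#S ≤ 2·4`;
* `card_symmDiff_le_two_of_bundle` — hence **the fundamental sets of two bundled chords differ by at most two forest outputs** (a single output or
  a `σ`-pair, as in the calibration core CONS-P3).
-/

set_option linter.dupNamespace false -- `Summit.PneNP.PneNP.…`: summit = sub-problem name (D-0017 single-conjunct layout)

open Finset Module Literature.Computability.Complexity
open scoped symmDiff
open Summit.PneNP.PneNP.Theorems.PstarTyped (Typed)
open Summit.PneNP.PneNP.Theorems.PstarSALevel (varSet bdry BoundaryExpanding SimpleOverlap)
open Summit.PneNP.PneNP.Theorems.PstarGapLinearised (andPair andPair_subset_varSet)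
open Summit.PneNP.PneNP.Theorems.PstarChordEndgameTools (not_two_shared mem_andPair_iff)
open Summit.PneNP.PneNP.Theorems.PstarCentreFree (vars_mem_varSet)
open Summit.PneNP.PneNP.Theorems.PstarCubeIdeals (IsAffineFn)
open Summit.PneNP.PneNP.Theorems.PstarRankRigidityTwo (linPart)
open Summit.PneNP.PneNP.Theorems.PstarProductRank (qform polar)
open Summit.PneNP.PneNP.Theorems.PstarPathRank (AndAdj)
open Summit.PneNP.PneNP.Theorems.PstarReadSumset (V2)
open Summit.PneNP.PneNP.Theorems.PstarXorElimination (pdeg)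
open Summit.PneNP.PneNP.Theorems.PstarXCore (xpair mem_xpair)
open Summit.PneNP.PneNP.Theorems.PstarChordSystemMap (omega)
open Summit.PneNP.PneNP.Theorems.PstarChordBridgeTools
open Summit.PneNP.PneNP.Theorems.PstarChordBridge
open Summit.PneNP.PneNP.Theorems.PstarChordBridgeFundamental (odd_of_end mem_xpair_of_odd)
open Summit.PneNP.PneNP.Theorems.PstarChordBridgeCollapse (Bundle)
open Summit.PneNP.PneNP.Theorems.PstarChordBridgeExchange (xpdeg_symmDiff_cast)
open Summit.PneNP.PneNP.Theorems.PstarChordBridgeBundle (bundle_adj)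

namespace Summit.PneNP.PneNP.Theorems.PstarChordBridgeMultipartite

variable {n m : ℕ}

/-! ## Boundary variables of a family -/

/-- **Boundary variables are lone XOR vertices or lone AND variables**: on a pure instance, a boundary variable of `S` is an XOR vertex of
slot-degree `1` in `S` or an AND variable lying in the AND pair of exactly one output of `S`. -/
theorem bdry_cases (I : LocalMap 4 n m) (hI : I.IsPure xorAndPred) {S : Finset (Fin m)} {v : Fin n} (hv : v ∈ bdry I S) :
    xpdeg I S v = 1 ∨ ∃ k ∈ S, v ∈ andPair I k ∧ ∀ k' ∈ S, v ∈ andPair I k' → k' = k := by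
  classical
  unfold PstarSALevel.bdry at hv
  rw [mem_filter] at hv
  obtain ⟨k, hk⟩ := card_eq_one.1 hv.2
  have hkS : k ∈ S.filter fun j => v ∈ varSet I j := by rw [hk]; exact mem_singleton_self k
  rw [mem_filter] at hkS
  have huniq : ∀ k' ∈ S, v ∈ varSet I k' → k' = k := fun k' hk' hv' => by
    have : k' ∈ S.filter fun j => v ∈ varSet I j := mem_filter.2 ⟨hk', hv'⟩
    rw [hk] at this; exact mem_singleton.1 this
  obtain ⟨s, hs⟩ : ∃ s : Fin 4, I.vars k s = v := by
    have := hkS.2; unfold PstarSALevel.varSet at this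
    obtain ⟨s, -, hs⟩ := mem_image.1 this; exact ⟨s, hs⟩
  by_cases hs2 : s.val < 2
  · -- an XOR slot: slot-degree exactly one
    left
    have h01 : I.vars k 0 ≠ I.vars k 1 := fun h => absurd (hI.2 k h) (by decide)
    have hle : xpdeg I S v ≤ 1 := by
      unfold xpdeg pdeg
      have hsub0 : S.filter (fun j => I.vars j 0 = v) ⊆ {k} := fun j hj => by
        rw [mem_filter] at hj; exact mem_singleton.2 (huniq j hj.1 (hj.2 ▸ vars_mem_varSet I j 0))
      have hsub1 : S.filter (fun j => I.vars j 1 = v) ⊆ {k} := fun j hj => by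
        rw [mem_filter] at hj; exact mem_singleton.2 (huniq j hj.1 (hj.2 ▸ vars_mem_varSet I j 1))
      have hdisj : Disjoint (S.filter fun j => I.vars j 0 = v) (S.filter fun j => I.vars j 1 = v) := by
        rw [disjoint_left]; intro j hj hj'
        rw [mem_filter] at hj hj'
        exact absurd (hI.2 j (hj.2.trans hj'.2.symm)) (by decide)
      rw [← card_union_of_disjoint hdisj]
      exact (card_le_card (union_subset hsub0 hsub1)).trans (card_singleton k).le
    have hge : 1 ≤ xpdeg I S v := by
      change 1 ≤ (S.filter fun j => I.vars j 0 = v).card + (S.filter fun j => I.vars j 1 = v).card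
      have : s = 0 ∨ s = 1 := by
        rcases s with ⟨s, h4⟩; simp only [Fin.ext_iff] at *; omega
      rcases this with rfl | rfl
      · have hmem : k ∈ S.filter fun j => I.vars j 0 = v := mem_filter.2 ⟨hkS.1, hs⟩
        have := card_pos.2 ⟨k, hmem⟩; omega
      · have hmem : k ∈ S.filter fun j => I.vars j 1 = v := mem_filter.2 ⟨hkS.1, hs⟩
        have := card_pos.2 ⟨k, hmem⟩; omega
    omega
  · -- an AND slot
    right
    have hva : v ∈ andPair I k := by
      rw [mem_andPair_iff]
      have : s = 2 ∨ s = 3 := by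
        rcases s with ⟨s, h4⟩; simp only [Fin.ext_iff] at *; omega
      rcases this with rfl | rfl
      · exact Or.inl hs.symm
      · exact Or.inr hs.symm
    exact ⟨k, hkS.1, hva, fun k' hk' hv' => huniq k' hk' (andPair_subset_varSet I k' hv')⟩

/-! ## The accounting -/

/-- **Complete multipartite AND-patterns inside an expanding core are tiny.**  See the module docstring. -/
theorem card_le_two_of_pattern (I : LocalMap 4 n m) (hI : I.IsPure xorAndPred) (hS : SimpleOverlap I) {r : ℕ}
    (hB : BoundaryExpanding r I) {S : Finset (Fin m)} (hSr : S.card ≤ r) {O : Finset (Fin n)} (hO : O.card ≤ 4)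
    (hodd : ∀ w, Odd (xpdeg I S w) → w ∈ O) (v : Fin n → V2) (hadj : ∀ c d, AndAdj I S c d ↔ omega (v c) (v d) = 1) : S.card ≤ 2 := by
  classical
  -- labels of adjacent variables are distinct and non-zero
  have hω : ∀ a b : V2, omega a b = 1 → a ≠ 0 ∧ b ≠ 0 ∧ a ≠ b := by
    unfold omega; rintro ⟨a₁, a₂⟩ ⟨b₁, b₂⟩; revert a₁ a₂ b₁ b₂; decide
  have hωne : ∀ a b : V2, a ≠ 0 → b ≠ 0 → a ≠ b → omega a b = 1 := by
    unfold omega; rintro ⟨a₁, a₂⟩ ⟨b₁, b₂⟩; revert a₁ a₂ b₁ b₂; decide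
  have hself : ∀ a : V2, omega a a = 0 := by unfold omega; rintro ⟨a₁, a₂⟩; revert a₁ a₂; decide
  -- the AND pair of an output of `S` is an adjacent pair
  have hadjk : ∀ k ∈ S, omega (v (I.vars k 2)) (v (I.vars k 3)) = 1 := fun k hk => (hadj _ _).1 ⟨k, hk, Or.inl ⟨rfl, rfl⟩⟩
  by_cases hstar : ∃ c₀, ∀ k ∈ S, c₀ ∈ andPair I k
  · -- a star: the outputs pairwise share `c₀`, hence are XOR-disjoint; all XOR vertices are odd
    obtain ⟨c₀, hc₀⟩ := hstar
    have hxdeg : ∀ k ∈ S, ∀ s : Fin 4, s.val < 2 → xpdeg I S (I.vars k s) = 1 := by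
      intro k hk s hs
      have h01 : I.vars k 0 ≠ I.vars k 1 := fun h => absurd (hI.2 k h) (by decide)
      -- no other output of `S` touches `I.vars k s`
      have huniq : ∀ k' ∈ S, I.vars k s ∈ xpair I k' → k' = k := by
        intro k' hk' hmem
        by_contra hne
        have hc₀k : c₀ ∈ varSet I k := andPair_subset_varSet I k (hc₀ k hk)
        have hc₀k' : c₀ ∈ varSet I k' := andPair_subset_varSet I k' (hc₀ k' hk')
        have hw : I.vars k s ∈ varSet I k' := by
          rcases (mem_xpair I).1 hmem with h | h
          · rw [h]; exact vars_mem_varSet I k' 0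
          · rw [h]; exact vars_mem_varSet I k' 1
        have hne' : c₀ ≠ I.vars k s := by
          intro h
          rcases (mem_andPair_iff I k c₀).1 (hc₀ k hk) with h2 | h3
          · exact absurd (hI.2 k (h2.symm.trans h)) (by
              intro h23; have := congrArg Fin.val h23; simp at this; omega)
          · exact absurd (hI.2 k (h3.symm.trans h)) (by
              intro h33; have := congrArg Fin.val h33; simp at this; omega)
        exact not_two_shared I hS (Ne.symm hne) hne' hc₀k hc₀k' (vars_mem_varSet I k s) hw
      unfold xpdeg pdeg
      have hs' : s = 0 ∨ s = 1 := by rcases s with ⟨s, h4⟩; simp only [Fin.ext_iff] at *; omega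
      rcases hs' with rfl | rfl
      · have h0 : S.filter (fun j => I.vars j 0 = I.vars k 0) = {k} := by
          ext j; rw [mem_filter, mem_singleton]
          exact ⟨fun ⟨hj, h⟩ => huniq j hj ((mem_xpair I).2 (Or.inl h.symm)), fun h => by rw [h]; exact ⟨hk, rfl⟩⟩
        have h1 : S.filter (fun j => I.vars j 1 = I.vars k 0) = ∅ := by
          refine filter_eq_empty_iff.2 fun j hj h => ?_
          have := huniq j hj ((mem_xpair I).2 (Or.inr h.symm)); subst this; exact h01 h.symm
        rw [h0, h1, card_singleton, card_empty]
      · have h0 : S.filter (fun j => I.vars j 0 = I.vars k 1) = ∅ := by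
          refine filter_eq_empty_iff.2 fun j hj h => ?_
          have := huniq j hj ((mem_xpair I).2 (Or.inl h.symm)); subst this; exact h01 h
        have h1 : S.filter (fun j => I.vars j 1 = I.vars k 1) = {k} := by
          ext j; rw [mem_filter, mem_singleton]
          exact ⟨fun ⟨hj, h⟩ => huniq j hj ((mem_xpair I).2 (Or.inr h.symm)), fun h => by rw [h]; exact ⟨hk, rfl⟩⟩
        rw [h0, h1, card_singleton, card_empty]
    -- the map `(k, slot) ↦ XOR vertex` from `S × {0,1}` into `O` is injective
    have hinj : (S.image fun k => I.vars k 0) ∪ (S.image fun k => I.vars k 1) ⊆ O := by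
      intro w hw
      rcases mem_union.1 hw with hw | hw
      · obtain ⟨k, hk, rfl⟩ := mem_image.1 hw
        exact hodd _ (by rw [hxdeg k hk 0 (by decide)]; exact odd_one)
      · obtain ⟨k, hk, rfl⟩ := mem_image.1 hw
        exact hodd _ (by rw [hxdeg k hk 1 (by decide)]; exact odd_one)
    have hinj0 : Set.InjOn (fun k => I.vars k 0) S := fun k hk k' hk' h => by
      simp only at h
      have hd := hxdeg k hk 0 (by decide)
      change (S.filter fun j => I.vars j 0 = I.vars k 0).card + (S.filter fun j => I.vars j 1 = I.vars k 0).card = 1 at hd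
      have hk1 : k ∈ S.filter fun j => I.vars j 0 = I.vars k 0 := mem_filter.2 ⟨hk, rfl⟩
      have hk2 : k' ∈ S.filter fun j => I.vars j 0 = I.vars k 0 := mem_filter.2 ⟨hk', h.symm⟩
      have hle : (S.filter fun j => I.vars j 0 = I.vars k 0).card ≤ 1 := by omega
      exact card_le_one.1 hle k hk1 k' hk2
    have hinj1 : Set.InjOn (fun k => I.vars k 1) S := fun k hk k' hk' h => by
      simp only at h
      have hd := hxdeg k hk 1 (by decide)
      change (S.filter fun j => I.vars j 0 = I.vars k 1).card + (S.filter fun j => I.vars j 1 = I.vars k 1).card = 1 at hd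
      have hk1 : k ∈ S.filter fun j => I.vars j 1 = I.vars k 1 := mem_filter.2 ⟨hk, rfl⟩
      have hk2 : k' ∈ S.filter fun j => I.vars j 1 = I.vars k 1 := mem_filter.2 ⟨hk', h.symm⟩
      have hle : (S.filter fun j => I.vars j 1 = I.vars k 1).card ≤ 1 := by omega
      exact card_le_one.1 hle k hk1 k' hk2
    have hdisj : Disjoint (S.image fun k => I.vars k 0) (S.image fun k => I.vars k 1) := by
      rw [disjoint_left]
      intro w hw hw'
      obtain ⟨k, hk, rfl⟩ := mem_image.1 hw
      obtain ⟨k', hk', h⟩ := mem_image.1 hw'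
      have hd := hxdeg k hk 0 (by decide)
      change (S.filter fun j => I.vars j 0 = I.vars k 0).card + (S.filter fun j => I.vars j 1 = I.vars k 0).card = 1 at hd
      have hk1 : k ∈ S.filter fun j => I.vars j 0 = I.vars k 0 := mem_filter.2 ⟨hk, rfl⟩
      have hk2 : k' ∈ S.filter fun j => I.vars j 1 = I.vars k 0 := mem_filter.2 ⟨hk', h⟩
      have := card_pos.2 ⟨k, hk1⟩
      have := card_pos.2 ⟨k', hk2⟩
      omega
    have hcard := card_le_card hinj
    rw [card_union_of_disjoint hdisj, card_image_of_injOn hinj0, card_image_of_injOn hinj1] at hcard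
    omega
  · -- no star: every AND variable of `S` lies in two outputs, so it is not a boundary variable
    push Not at hstar
    have htwo : ∀ k ∈ S, ∀ c ∈ andPair I k, ∃ k' ∈ S, k' ≠ k ∧ c ∈ andPair I k' := by
      intro k hk c hc
      -- the partner `d` of `c` in `k`, and an output `k''` avoiding `d`
      obtain ⟨d, hd, hcd⟩ : ∃ d, d ∈ andPair I k ∧ omega (v c) (v d) = 1 := by
        rcases (mem_andPair_iff I k c).1 hc with rfl | rfl
        · exact ⟨I.vars k 3, (mem_andPair_iff I k _).2 (Or.inr rfl), hadjk k hk⟩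
        · refine ⟨I.vars k 2, (mem_andPair_iff I k _).2 (Or.inl rfl), ?_⟩
          have := hadjk k hk; unfold omega at this ⊢; rw [← this]; ring
      obtain ⟨k'', hk'', hdk''⟩ := hstar d
      -- one of the AND variables of `k''` has a label different from `v c` (their labels differ from each other)
      have hx := hadjk k'' hk''
      obtain ⟨hc0, -, -⟩ := hω _ _ hcd
      obtain ⟨hx0, hy0, hxy⟩ := hω _ _ hx
      obtain ⟨x, hxk'', hvx⟩ : ∃ x, x ∈ andPair I k'' ∧ v x ≠ v c := by
        by_cases h2 : v (I.vars k'' 2) = v c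
        · refine ⟨I.vars k'' 3, (mem_andPair_iff I k'' _).2 (Or.inr rfl), fun h3 => hxy (h2.trans h3.symm)⟩
        · exact ⟨I.vars k'' 2, (mem_andPair_iff I k'' _).2 (Or.inl rfl), h2⟩
      have hvx0 : v x ≠ 0 := by
        rcases (mem_andPair_iff I k'' x).1 hxk'' with rfl | rfl
        · exact hx0
        · exact hy0
      -- `c ~ x`, so some output `k'` of `S` has AND pair `{c, x}`; it is not `k` since `x ≠ d` … unless `x = d`, excluded by `d ∉ k''`
      have hcx : omega (v c) (v x) = 1 := hωne _ _ hc0 hvx0 (Ne.symm hvx)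
      obtain ⟨k', hk', hpair⟩ := (hadj c x).2 hcx
      have hxd : x ≠ d := fun h => hdk'' (h ▸ hxk'')
      have hxc : x ≠ c := fun h => hvx (by rw [h])
      refine ⟨k', hk', fun hkk => ?_, (mem_andPair_iff I k' c).2 ?_⟩
      · -- `k' = k` would make `{c, x} = {c, d}` as AND pairs
        subst hkk
        rcases hpair with ⟨h2, h3⟩ | ⟨h2, h3⟩
        · rcases (mem_andPair_iff I k' d).1 hd with hd2 | hd3
          · exact hc0 (by
              have : c = d := h2.symm.trans hd2.symm
              rw [this, hself] at hcd; exact absurd hcd zero_ne_one) |>.elim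
          · exact hxd (h3 ▸ hd3 ▸ rfl) |>.elim
        · rcases (mem_andPair_iff I k' d).1 hd with hd2 | hd3
          · exact hxd (h2 ▸ hd2 ▸ rfl) |>.elim
          · exact hc0 (by
              have : c = d := h3.symm.trans hd3.symm
              rw [this, hself] at hcd; exact absurd hcd zero_ne_one) |>.elim
      · rcases hpair with ⟨h2, -⟩ | ⟨-, h3⟩
        · exact Or.inl h2.symm
        · exact Or.inr h3.symm
    -- hence the boundary of `S` consists of odd XOR vertices
    have hbd : bdry I S ⊆ O := by
      intro w hw
      rcases bdry_cases I hI hw with h1 | ⟨k, hk, hwk, huniq⟩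
      · exact hodd w (by rw [h1]; exact odd_one)
      · obtain ⟨k', hk', hne, hwk'⟩ := htwo k hk w hwk
        exact absurd (huniq k' hk' hwk') hne
    have hexp := hB S hSr
    have := card_le_card hbd
    omega

/-- **Bundled chords differ by at most two forest outputs.**  If two distinct chords of well-formed bridge data (pure `(r,3/2)`-expanding
instance with simple overlaps, `#J₀ ≤ r`) form an elliptic bundle, then `#(D e ∆ D e') ≤ 2`. -/
theorem card_symmDiff_le_two_of_bundle (I : LocalMap 4 n m) (hI : I.IsPure xorAndPred) (hS : SimpleOverlap I) {r : ℕ}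
    (hB : BoundaryExpanding r I) {B : BridgeData n m} (hW : B.WF I) (hr : B.J₀.card ≤ r) {e e' : Fin m} (he : e ∈ B.N) (he' : e' ∈ B.N)
    (hb : Bundle I B e e') : (B.D e ∆ B.D e').card ≤ 2 := by
  classical
  obtain ⟨ν₁, ν₂, h₁, h₂, κ, hbκ⟩ := hb
  have heD : e ∉ B.D e := fun h => (mem_sdiff.1 (hW.hD e he h)).2 he
  have heD' : e' ∉ B.D e' := fun h => (mem_sdiff.1 (hW.hD e' he' h)).2 he'
  -- odd vertices of the symmetric difference are ends of `e` or `e'`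
  have hodd : ∀ w, Odd (xpdeg I (B.D e ∆ B.D e') w) → w ∈ xpair I e ∪ xpair I e' := by
    intro w hw
    rw [← ZMod.natCast_eq_one_iff_odd, xpdeg_symmDiff_cast] at hw
    by_cases h1 : Odd (xpdeg I (B.D e) w)
    · exact mem_union_left _ (mem_xpair_of_odd I heD (hW.hDeven e he) h1)
    · have h0 : (xpdeg I (B.D e) w : ZMod 2) = 0 := (ZMod.natCast_eq_zero_iff_even).2 (Nat.not_odd_iff_even.1 h1)
      rw [h0, zero_add, ZMod.natCast_eq_one_iff_odd] at hw
      exact mem_union_right _ (mem_xpair_of_odd I heD' (hW.hDeven e' he') hw)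
  have hO : (xpair I e ∪ xpair I e').card ≤ 4 :=
    (card_union_le _ _).trans (Nat.add_le_add (PstarXCore.card_xpair_le I e) (PstarXCore.card_xpair_le I e'))
  have hSr : (B.D e ∆ B.D e').card ≤ r := by
    refine le_trans (card_le_card fun k hk => ?_) hr
    rcases (mem_symmDiff.1 hk) with ⟨h, -⟩ | ⟨h, -⟩
    · exact (mem_sdiff.1 (hW.hD e he h)).1
    · exact (mem_sdiff.1 (hW.hD e' he' h)).1
  refine card_le_two_of_pattern I hI hS hB hSr hO hodd
    (fun c => (linPart h₁ (Pi.single c 1), linPart h₂ (Pi.single c 1))) fun c d => ?_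
  have h := bundle_adj I hI hS B h₁ h₂ hbκ c d
  show AndAdj I (B.D e ∆ B.D e') c d ↔
    linPart h₁ (Pi.single c 1) * linPart h₂ (Pi.single d 1) + linPart h₂ (Pi.single c 1) * linPart h₁ (Pi.single d 1) = 1
  constructor
  · intro ha
    rw [if_pos ha] at h
    linear_combination h.symm
  · intro hω
    by_contra hna
    rw [if_neg hna] at h
    have : (0 : ZMod 2) = 1 := by linear_combination h + hω
    exact zero_ne_one this

end Summit.PneNP.PneNP.Theorems.PstarChordBridgeMultipartite
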